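import Summits.QuantumFields.YangMills.Theorems.UV3ExpFDerivLipschitz
import Summits.QuantumFields.YangMills.Theorems.UV3QlogDerivativeBounds
import Literature.MathematicalPhysics.QuantumFieldTheory.Balaban1983to89.T4EMLFibreAC
import HarnessLib

/-!
# R3 (cell `ym3-torus`, YM₃ on T³ — a ladder RUNG, NOT d = 4, NOT infinite volume, NOT a mass gap, NOT the Clay problem) —
# **(H_K ∀-L, brick B3a) Λ₂: THE DERIVATIVE OF THE PRINTED exp-mean-log FIBRE MAP IS BOUNDED (`K₁ ≤ 14`) AND LIPSCHITZ (`Λ₂ ≤ 250`) ON THE EUCLIDEAN BALL OF RADIUS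
# `1∕24` ABOUT EVERY GUARDED UNIT QUATERNION, for every `Σcᵢ ≤ 1` — closed constants from bricks B1∕B2**

Width seat `ym-ust-19936-w8` g13 on crux `stmt-QuantumFields-19936` `UnitScaleTilt.HistoryTailL` (`--supports`, helper; THEOREMS ONLY, 0 `def`, 0 `sorry`); ★★OWNER WORD 99
(2026-08-30) (ii): «B3 CONDITIONAL — after B1∕B2∕B4 ✓ and no named want open; in n08-d's docking shape»; bricks B1 ✓`UV3ExpFDerivLipschitz` (p764444), B2 ✓`UV3QlogDerivativeBounds`
(p764706), B4 ✓`UV3WindowNetSU2` (p764607).  [folklore] calculus in pub-balaban's quaternion model (lit ✓`T4EMLFibreAC`: `Yf`, `kf`, `YD`, `kD`, `YD_apply`, `kD_apply`), Mathlib-only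
otherwise.  Sequel (same seat): B3b ✓`UV3FibreLocalInjectivity` — the chart map, the tangent floor and the LOCAL INJECTIVITY on chart balls of radius `∝ (1 − Σcᵢ)`.

THE MATHEMATICS.  The fibre map `k(u) = exp(Y(u))·u`, `Y(u) = Σcᵢ qlog(aᵢū)` (unit `aᵢ`, `cᵢ ≥ 0`, `Σcᵢ ≤ 1`), has derivative `k′(u) v = e^{Y}·v + D exp(Y)(Y′(u)v)·u`
(lit `kD_apply`).  On the EUCLIDEAN ball `‖u − u₀‖ ≤ 1∕24` of `ℍ` about a guarded unit `u₀` (`‖aᵢū₀ − 1‖ ≤ 1∕3` — print's guard `deltaSU ≤ 1∕3`) every argument `aᵢū`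
lies in B2's region `‖· − 1‖ ≤ 3∕8` (§1), so `‖Y‖ ≤ 3∕5`, `Y` is `8∕5`-Lipschitz, `‖Y′‖ ≤ M₁ = (2 − e^{3∕5})⁻¹`, `Y′` is `M₂ = M₁²(8∕5)e^{3∕5}`-Lipschitz (B2 termwise), `D exp` is
bounded by and Lipschitz with `e^{3∕5}` on `‖·‖ ≤ 3∕5` (B1); four-term telescoping gives **`‖k′(u) − k′(u′)‖ ≤ Λ₂‖u − u′‖`,
`Λ₂ = e^{3∕5}·(8∕5 + M₁ + (25∕24)((8∕5)M₁ + M₂)) ≤ 250`**, and `‖k′(u)‖ ≤ K₁ = 1 + (3∕5)e^{3∕5} + (25∕24)e^{3∕5}M₁ ≤ 14` (§2).  No smallness of `Σcᵢ`: the region is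
Euclidean (off the sphere too), which is what the mean-value inequality on convex chart balls needs downstream.

WHY (numbers, LOCATE-g48 §1∕§5).  The explicit (H_K) constant at `N = 2` stops at `L^{d−1} ≤ 400` ONLY because global injectivity (n08-w3 part 30C) does; the sheet-count
road replaces it by per-ball injectivity of radius `κ₀∕(2Λ_f) ∝ (1 − Σcᵢ) = L^{1−d}` — Λ₂ is the one transcendental letter that road was missing (n08-d `N08-ALL-L-LAMBDA2-DESIGN-g48.md`).
NO assembly ∕ `…AllL` ∕ `hw_su2_all` this generation (★★OWNER WORD 99).

CONTENTS.  §1 region letters: `norm_mul_star_sub_one_le_region` (`‖aᵢū − 1‖ ≤ 3∕8`), `norm_mul_star_sub_mul_star`, `norm_Yf_le_region` (`≤ 3∕5`), `norm_Yf_sub_Yf_le` (`8∕5`),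
`norm_YD_le` (`M₁`), `norm_YD_sub_YD_le` (`M₂`), `norm_fderiv_exp_Yf_le`, `norm_exp_Yf_le`.  §2 ★ `norm_kD_le` (`K₁`) · ★★ `norm_kD_sub_kD_le` (Λ₂) · numerals `K₁_le` (`≤ 14`),
`Λ₂_le` (`≤ 250`).

HONEST SCOPE.  Calculus; nothing of (H_K) at `L ≥ 21`, hTop, the χ record, (O‴χₛ), EX, `HistoryTailL` (19936) or any summit statement is proved here; hTop is SUPPLY w.r.t. the
registered 19936 v6 door (★★OWNER WORD 98).  YM₃ on T³ is rung R3 — NOT d = 4, NOT infinite volume, NOT a mass gap, NOT the Clay problem; the Yang–Mills mass gap is NOT proved.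

References (orientation only; every declaration is kernel-proved [folklore]): T. Bałaban, Commun. Math. Phys. **109** (1987) 249–301 [Balaban1987RG1] ((0.4) p. 253, the
averaging whose one-variable law is `k`).
-/

set_option autoImplicit false

noncomputable section

open NormedSpace Set Metric Function
open scoped RealInnerProductSpace Topology Quaternion

namespace Summit.QuantumFields.YangMills.Theorems.UV3FibreDerivativeLipschitz

open Literature.MathematicalPhysics.QuantumFieldTheory.Balaban1983to89
open Literature.MathematicalPhysics.QuantumFieldTheory.Balaban1983to89.T4QuatExpLog
open Literature.MathematicalPhysics.QuantumFieldTheory.Balaban1983to89.T4EMLFibreAC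
open Summit.QuantumFields.YangMills.Theorems.UV3ExpFDerivLipschitz (norm_fderiv_exp_sub_le norm_fderiv_exp_le' norm_exp_sub_exp_le_of_norm_le)
open Summit.QuantumFields.YangMills.Theorems.UV3QlogDerivativeBounds (floor_pos floor_ge exp_three_fifths_lt norm_qlog_le_three_fifths norm_fderiv_qlog_le
  norm_qlog_sub_qlog_le norm_fderiv_qlog_sub_le inv_floor_le_six lipschitz_const_le)

variable {ι : Type*} [Fintype ι]

/-! ## §1 The region: the Euclidean ball of radius `1∕24` about a guarded unit quaternion -/

/-- ON THE REGION every argument `aᵢū` is `3∕8`-close to `1`: `‖aᵢū₀ − 1‖ ≤ 1∕3`, `‖aᵢ‖ = 1`, `‖u − u₀‖ ≤ 1∕24` ⟹ `‖aᵢū − 1‖ ≤ 3∕8`. [folklore] -/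
theorem norm_mul_star_sub_one_le_region {a u₀ u : ℍ} (ha : ‖a‖ = 1) (hg : ‖a * star u₀ - 1‖ ≤ 1 / 3) (hu : ‖u - u₀‖ ≤ 1 / 24) :
    ‖a * star u - 1‖ ≤ 3 / 8 := by
  have e : a * star u - 1 = (a * star u₀ - 1) + a * star (u - u₀) := by rw [star_sub, mul_sub]; abel
  rw [e]
  calc ‖(a * star u₀ - 1) + a * star (u - u₀)‖ ≤ ‖a * star u₀ - 1‖ + ‖a * star (u - u₀)‖ := norm_add_le _ _
    _ = ‖a * star u₀ - 1‖ + ‖u - u₀‖ := by rw [norm_mul, Quaternion.norm_star, ha, one_mul]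
    _ ≤ 1 / 3 + 1 / 24 := add_le_add hg hu
    _ = 3 / 8 := by norm_num

/-- The difference of two arguments: `‖aū − aū′‖ = ‖u − u′‖` for unit `a`. [folklore] -/
theorem norm_mul_star_sub_mul_star {a : ℍ} (ha : ‖a‖ = 1) (u u' : ℍ) : ‖a * star u - a * star u'‖ = ‖u - u'‖ := by
  rw [← mul_sub, ← star_sub, norm_mul, Quaternion.norm_star, ha, one_mul]

section Region

variable {a : ι → ℍ} (c : ι → ℝ) {u₀ : ℍ}

/-- `‖Y(u)‖ ≤ 3∕5` on the region (B2 `norm_qlog_le_three_fifths` termwise, `Σcᵢ ≤ 1`). [folklore] -/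
theorem norm_Yf_le_region (ha : ∀ i, ‖a i‖ = 1) (hc : ∀ i, 0 ≤ c i) (hs : ∑ i, c i ≤ 1) (hg : ∀ i, ‖a i * star u₀ - 1‖ ≤ 1 / 3)
    {u : ℍ} (hu : ‖u - u₀‖ ≤ 1 / 24) : ‖Yf a c u‖ ≤ 3 / 5 := by
  rw [Yf]
  calc ‖∑ i, c i • qlog (a i * star u)‖ ≤ ∑ i, ‖c i • qlog (a i * star u)‖ := norm_sum_le _ _
    _ ≤ ∑ i, c i * (3 / 5) := Finset.sum_le_sum fun i _ => by
        rw [norm_smul, Real.norm_of_nonneg (hc i)]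
        exact mul_le_mul_of_nonneg_left (norm_qlog_le_three_fifths (norm_mul_star_sub_one_le_region (ha i) (hg i) hu)) (hc i)
    _ = (∑ i, c i) * (3 / 5) := by rw [Finset.sum_mul]
    _ ≤ 1 * (3 / 5) := mul_le_mul_of_nonneg_right hs (by norm_num)
    _ = 3 / 5 := one_mul _

/-- `Y` is `8∕5`-Lipschitz on the region (B2 `norm_qlog_sub_qlog_le` termwise). [folklore] -/
theorem norm_Yf_sub_Yf_le (ha : ∀ i, ‖a i‖ = 1) (hc : ∀ i, 0 ≤ c i) (hs : ∑ i, c i ≤ 1) (hg : ∀ i, ‖a i * star u₀ - 1‖ ≤ 1 / 3)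
    {u u' : ℍ} (hu : ‖u - u₀‖ ≤ 1 / 24) (hu' : ‖u' - u₀‖ ≤ 1 / 24) : ‖Yf a c u - Yf a c u'‖ ≤ 8 / 5 * ‖u - u'‖ := by
  rw [Yf, Yf, ← Finset.sum_sub_distrib]
  calc ‖∑ i, (c i • qlog (a i * star u) - c i • qlog (a i * star u'))‖ ≤ ∑ i, ‖c i • qlog (a i * star u) - c i • qlog (a i * star u')‖ := norm_sum_le _ _
    _ ≤ ∑ i, c i * (8 / 5 * ‖u - u'‖) := Finset.sum_le_sum fun i _ => by
        rw [← smul_sub, norm_smul, Real.norm_of_nonneg (hc i)]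
        refine mul_le_mul_of_nonneg_left ?_ (hc i)
        have h := norm_qlog_sub_qlog_le (norm_mul_star_sub_one_le_region (ha i) (hg i) hu) (norm_mul_star_sub_one_le_region (ha i) (hg i) hu')
        rwa [norm_mul_star_sub_mul_star (ha i)] at h
    _ = (∑ i, c i) * (8 / 5 * ‖u - u'‖) := by rw [Finset.sum_mul]
    _ ≤ 1 * (8 / 5 * ‖u - u'‖) := mul_le_mul_of_nonneg_right hs (by positivity)
    _ = 8 / 5 * ‖u - u'‖ := one_mul _

/-- `‖Y′(u)‖ ≤ M₁ = (2 − e^{3∕5})⁻¹` on the region (B2 `norm_fderiv_qlog_le` termwise; `‖aᵢv̄‖ = ‖v‖`). [folklore] -/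
theorem norm_YD_le (ha : ∀ i, ‖a i‖ = 1) (hc : ∀ i, 0 ≤ c i) (hs : ∑ i, c i ≤ 1) (hg : ∀ i, ‖a i * star u₀ - 1‖ ≤ 1 / 3)
    {u : ℍ} (hu : ‖u - u₀‖ ≤ 1 / 24) : ‖YD a c u‖ ≤ (2 - Real.exp (3 / 5))⁻¹ := by
  have hM0 : 0 ≤ (2 - Real.exp (3 / 5))⁻¹ := inv_nonneg.2 floor_pos.le
  refine ContinuousLinearMap.opNorm_le_bound _ hM0 fun v => ?_
  rw [YD_apply]
  calc ‖∑ i, c i • fderiv ℝ qlog (a i * star u) (a i * star v)‖ ≤ ∑ i, ‖c i • fderiv ℝ qlog (a i * star u) (a i * star v)‖ := norm_sum_le _ _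
    _ ≤ ∑ i, c i * ((2 - Real.exp (3 / 5))⁻¹ * ‖v‖) := Finset.sum_le_sum fun i _ => by
        rw [norm_smul, Real.norm_of_nonneg (hc i)]
        refine mul_le_mul_of_nonneg_left ?_ (hc i)
        calc ‖fderiv ℝ qlog (a i * star u) (a i * star v)‖ ≤ ‖fderiv ℝ qlog (a i * star u)‖ * ‖a i * star v‖ := ContinuousLinearMap.le_opNorm _ _
          _ ≤ (2 - Real.exp (3 / 5))⁻¹ * ‖v‖ := by
              rw [norm_mul, Quaternion.norm_star, ha i, one_mul]
              exact mul_le_mul_of_nonneg_right (norm_fderiv_qlog_le (norm_mul_star_sub_one_le_region (ha i) (hg i) hu)) (norm_nonneg _)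
    _ = (∑ i, c i) * ((2 - Real.exp (3 / 5))⁻¹ * ‖v‖) := by rw [Finset.sum_mul]
    _ ≤ 1 * ((2 - Real.exp (3 / 5))⁻¹ * ‖v‖) := mul_le_mul_of_nonneg_right hs (by positivity)
    _ = (2 - Real.exp (3 / 5))⁻¹ * ‖v‖ := one_mul _

/-- `Y′` is `M₂`-Lipschitz on the region, `M₂ = ((2 − e^{3∕5})⁻¹)²·(8∕5)·e^{3∕5}` (B2 `norm_fderiv_qlog_sub_le` termwise). [folklore] -/
theorem norm_YD_sub_YD_le (ha : ∀ i, ‖a i‖ = 1) (hc : ∀ i, 0 ≤ c i) (hs : ∑ i, c i ≤ 1) (hg : ∀ i, ‖a i * star u₀ - 1‖ ≤ 1 / 3)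
    {u u' : ℍ} (hu : ‖u - u₀‖ ≤ 1 / 24) (hu' : ‖u' - u₀‖ ≤ 1 / 24) :
    ‖YD a c u - YD a c u'‖ ≤ ((2 - Real.exp (3 / 5))⁻¹) ^ 2 * (8 / 5) * Real.exp (3 / 5) * ‖u - u'‖ := by
  set M₂ : ℝ := ((2 - Real.exp (3 / 5))⁻¹) ^ 2 * (8 / 5) * Real.exp (3 / 5) with hM₂
  have hM0 : 0 ≤ M₂ := by positivity
  refine ContinuousLinearMap.opNorm_le_bound _ (by positivity) fun v => ?_
  rw [sub_apply, YD_apply, YD_apply, ← Finset.sum_sub_distrib]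
  calc ‖∑ i, (c i • fderiv ℝ qlog (a i * star u) (a i * star v) - c i • fderiv ℝ qlog (a i * star u') (a i * star v))‖
      ≤ ∑ i, ‖c i • fderiv ℝ qlog (a i * star u) (a i * star v) - c i • fderiv ℝ qlog (a i * star u') (a i * star v)‖ := norm_sum_le _ _
    _ ≤ ∑ i, c i * (M₂ * ‖u - u'‖ * ‖v‖) := Finset.sum_le_sum fun i _ => by
        rw [← smul_sub, norm_smul, Real.norm_of_nonneg (hc i), ← sub_apply]
        refine mul_le_mul_of_nonneg_left ?_ (hc i)
        calc ‖(fderiv ℝ qlog (a i * star u) - fderiv ℝ qlog (a i * star u')) (a i * star v)‖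
            ≤ ‖fderiv ℝ qlog (a i * star u) - fderiv ℝ qlog (a i * star u')‖ * ‖a i * star v‖ := ContinuousLinearMap.le_opNorm _ _
          _ ≤ (M₂ * ‖a i * star u - a i * star u'‖) * ‖v‖ := by
              rw [norm_mul, Quaternion.norm_star, ha i, one_mul]
              exact mul_le_mul_of_nonneg_right
                (norm_fderiv_qlog_sub_le (norm_mul_star_sub_one_le_region (ha i) (hg i) hu) (norm_mul_star_sub_one_le_region (ha i) (hg i) hu'))
                (norm_nonneg _)
          _ = M₂ * ‖u - u'‖ * ‖v‖ := by rw [norm_mul_star_sub_mul_star (ha i)]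
    _ = (∑ i, c i) * (M₂ * ‖u - u'‖ * ‖v‖) := by rw [Finset.sum_mul]
    _ ≤ 1 * (M₂ * ‖u - u'‖ * ‖v‖) := mul_le_mul_of_nonneg_right hs (by positivity)
    _ = M₂ * ‖u - u'‖ * ‖v‖ := one_mul _

/-- `‖D exp(Y(u))‖ ≤ e^{3∕5}` on the region (B1). [folklore] -/
theorem norm_fderiv_exp_Yf_le (ha : ∀ i, ‖a i‖ = 1) (hc : ∀ i, 0 ≤ c i) (hs : ∑ i, c i ≤ 1) (hg : ∀ i, ‖a i * star u₀ - 1‖ ≤ 1 / 3)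
    {u : ℍ} (hu : ‖u - u₀‖ ≤ 1 / 24) : ‖fderiv ℝ (exp : ℍ → ℍ) (Yf a c u)‖ ≤ Real.exp (3 / 5) :=
  (norm_fderiv_exp_le' _).trans (Real.exp_le_exp.2 (norm_Yf_le_region c ha hc hs hg hu))

/-- `‖e^{Y(u)}‖ ≤ 1 + (3∕5)e^{3∕5}` on the region (B1's Lipschitz bound of `exp` against `exp 0 = 1`). [folklore] -/
theorem norm_exp_Yf_le (ha : ∀ i, ‖a i‖ = 1) (hc : ∀ i, 0 ≤ c i) (hs : ∑ i, c i ≤ 1) (hg : ∀ i, ‖a i * star u₀ - 1‖ ≤ 1 / 3)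
    {u : ℍ} (hu : ‖u - u₀‖ ≤ 1 / 24) : ‖exp (Yf a c u)‖ ≤ 1 + 3 / 5 * Real.exp (3 / 5) := by
  have hY := norm_Yf_le_region c ha hc hs hg hu
  have h := norm_exp_sub_exp_le_of_norm_le (x := Yf a c u) (y := (0 : ℍ)) hY (by rw [norm_zero]; positivity)
  rw [exp_zero, sub_zero] at h
  calc ‖exp (Yf a c u)‖ = ‖(exp (Yf a c u) - 1) + 1‖ := by rw [sub_add_cancel]
    _ ≤ ‖exp (Yf a c u) - 1‖ + ‖(1 : ℍ)‖ := norm_add_le _ _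
    _ ≤ Real.exp (3 / 5) * (3 / 5) + 1 := by rw [norm_one]; exact add_le_add (h.trans (mul_le_mul_of_nonneg_left hY (Real.exp_pos _).le)) le_rfl
    _ = 1 + 3 / 5 * Real.exp (3 / 5) := by ring

/-! ## §2 ★★ The derivative of the fibre map: bound `K₁` and Lipschitz constant `Λ₂` on the region -/

/-- ★ `‖k′(u)‖ ≤ K₁ := 1 + (3∕5)e^{3∕5} + (25∕24)·e^{3∕5}·(2 − e^{3∕5})⁻¹` on the region (lit `kD_apply`, `‖u‖ ≤ 25∕24`). [folklore] -/
theorem norm_kD_le (ha : ∀ i, ‖a i‖ = 1) (hc : ∀ i, 0 ≤ c i) (hs : ∑ i, c i ≤ 1) (hu₀ : ‖u₀‖ = 1) (hg : ∀ i, ‖a i * star u₀ - 1‖ ≤ 1 / 3)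
    {u : ℍ} (hu : ‖u - u₀‖ ≤ 1 / 24) :
    ‖kD a c u‖ ≤ 1 + 3 / 5 * Real.exp (3 / 5) + 25 / 24 * Real.exp (3 / 5) * (2 - Real.exp (3 / 5))⁻¹ := by
  have hM0 : 0 ≤ (2 - Real.exp (3 / 5))⁻¹ := inv_nonneg.2 floor_pos.le
  have hun : ‖u‖ ≤ 25 / 24 := by
    calc ‖u‖ = ‖(u - u₀) + u₀‖ := by rw [sub_add_cancel]
      _ ≤ ‖u - u₀‖ + ‖u₀‖ := norm_add_le _ _
      _ ≤ 1 / 24 + 1 := add_le_add hu hu₀.le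
      _ = 25 / 24 := by norm_num
  have hE := norm_fderiv_exp_Yf_le c ha hc hs hg hu
  have hYD := norm_YD_le c ha hc hs hg hu
  have heY := norm_exp_Yf_le c ha hc hs hg hu
  refine ContinuousLinearMap.opNorm_le_bound _ (by positivity) fun v => ?_
  rw [kD_apply]
  have h1 : ‖exp (Yf a c u) * v‖ ≤ (1 + 3 / 5 * Real.exp (3 / 5)) * ‖v‖ :=
    (norm_mul_le _ _).trans (mul_le_mul_of_nonneg_right heY (norm_nonneg _))
  have h2 : ‖fderiv ℝ exp (Yf a c u) (YD a c u v) * u‖ ≤ (25 / 24 * Real.exp (3 / 5) * (2 - Real.exp (3 / 5))⁻¹) * ‖v‖ := by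
    calc ‖fderiv ℝ exp (Yf a c u) (YD a c u v) * u‖ ≤ ‖fderiv ℝ exp (Yf a c u) (YD a c u v)‖ * ‖u‖ := norm_mul_le _ _
      _ ≤ (‖fderiv ℝ (exp : ℍ → ℍ) (Yf a c u)‖ * (‖YD a c u‖ * ‖v‖)) * ‖u‖ :=
          mul_le_mul_of_nonneg_right ((ContinuousLinearMap.le_opNorm _ _).trans
            (mul_le_mul_of_nonneg_left (ContinuousLinearMap.le_opNorm _ _) (norm_nonneg _))) (norm_nonneg _)
      _ ≤ (Real.exp (3 / 5) * ((2 - Real.exp (3 / 5))⁻¹ * ‖v‖)) * (25 / 24) := by gcongr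
      _ = (25 / 24 * Real.exp (3 / 5) * (2 - Real.exp (3 / 5))⁻¹) * ‖v‖ := by ring
  calc ‖exp (Yf a c u) * v + fderiv ℝ exp (Yf a c u) (YD a c u v) * u‖
      ≤ ‖exp (Yf a c u) * v‖ + ‖fderiv ℝ exp (Yf a c u) (YD a c u v) * u‖ := norm_add_le _ _
    _ ≤ (1 + 3 / 5 * Real.exp (3 / 5)) * ‖v‖ + (25 / 24 * Real.exp (3 / 5) * (2 - Real.exp (3 / 5))⁻¹) * ‖v‖ := add_le_add h1 h2
    _ = (1 + 3 / 5 * Real.exp (3 / 5) + 25 / 24 * Real.exp (3 / 5) * (2 - Real.exp (3 / 5))⁻¹) * ‖v‖ := by ring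

/-- ★★ **Λ₂ — THE DERIVATIVE OF THE FIBRE MAP IS LIPSCHITZ ON THE REGION**: for unit `aᵢ`, `cᵢ ≥ 0`, `Σcᵢ ≤ 1`, a unit `u₀` in the guard `‖aᵢū₀ − 1‖ ≤ 1∕3`, and
`u, u′` in the Euclidean ball `‖· − u₀‖ ≤ 1∕24`:  `‖k′(u) − k′(u′)‖ ≤ Λ₂·‖u − u′‖`,
`Λ₂ = e^{3∕5}·(8∕5 + M₁ + (25∕24)·((8∕5)·M₁ + M₂))`, `M₁ = (2 − e^{3∕5})⁻¹`, `M₂ = M₁²·(8∕5)·e^{3∕5}` (four-term telescoping of lit `kD_apply` over B1∕B2). [folklore] -/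
theorem norm_kD_sub_kD_le (ha : ∀ i, ‖a i‖ = 1) (hc : ∀ i, 0 ≤ c i) (hs : ∑ i, c i ≤ 1) (hu₀ : ‖u₀‖ = 1) (hg : ∀ i, ‖a i * star u₀ - 1‖ ≤ 1 / 3)
    {u u' : ℍ} (hu : ‖u - u₀‖ ≤ 1 / 24) (hu' : ‖u' - u₀‖ ≤ 1 / 24) :
    ‖kD a c u - kD a c u'‖ ≤
      (Real.exp (3 / 5) * (8 / 5 + (2 - Real.exp (3 / 5))⁻¹ +
        25 / 24 * (8 / 5 * (2 - Real.exp (3 / 5))⁻¹ + ((2 - Real.exp (3 / 5))⁻¹) ^ 2 * (8 / 5) * Real.exp (3 / 5)))) * ‖u - u'‖ := by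
  set E : ℝ := Real.exp (3 / 5) with hE_def
  set M₁ : ℝ := (2 - Real.exp (3 / 5))⁻¹ with hM₁
  set M₂ : ℝ := M₁ ^ 2 * (8 / 5) * E with hM₂
  set δ : ℝ := ‖u - u'‖ with hδ
  have hE0 : 0 < E := Real.exp_pos _
  have hM0 : 0 ≤ M₁ := inv_nonneg.2 floor_pos.le
  have hun' : ‖u'‖ ≤ 25 / 24 := by
    calc ‖u'‖ = ‖(u' - u₀) + u₀‖ := by rw [sub_add_cancel]
      _ ≤ ‖u' - u₀‖ + ‖u₀‖ := norm_add_le _ _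
      _ ≤ 1 / 24 + 1 := add_le_add hu' hu₀.le
      _ = 25 / 24 := by norm_num
  -- the letters
  have hY : ‖Yf a c u‖ ≤ 3 / 5 := norm_Yf_le_region c ha hc hs hg hu
  have hY' : ‖Yf a c u'‖ ≤ 3 / 5 := norm_Yf_le_region c ha hc hs hg hu'
  have hYY : ‖Yf a c u - Yf a c u'‖ ≤ 8 / 5 * δ := norm_Yf_sub_Yf_le c ha hc hs hg hu hu'
  have hEu : ‖fderiv ℝ (exp : ℍ → ℍ) (Yf a c u)‖ ≤ E := norm_fderiv_exp_Yf_le c ha hc hs hg hu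
  have hEu' : ‖fderiv ℝ (exp : ℍ → ℍ) (Yf a c u')‖ ≤ E := norm_fderiv_exp_Yf_le c ha hc hs hg hu'
  have hEE : ‖fderiv ℝ (exp : ℍ → ℍ) (Yf a c u) - fderiv ℝ (exp : ℍ → ℍ) (Yf a c u')‖ ≤ E * (8 / 5 * δ) :=
    (norm_fderiv_exp_sub_le hY hY').trans (mul_le_mul_of_nonneg_left hYY hE0.le)
  have hee : ‖exp (Yf a c u) - exp (Yf a c u')‖ ≤ E * (8 / 5 * δ) :=
    (norm_exp_sub_exp_le_of_norm_le hY hY').trans (mul_le_mul_of_nonneg_left hYY hE0.le)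
  have hYD : ‖YD a c u‖ ≤ M₁ := norm_YD_le c ha hc hs hg hu
  have hYDD : ‖YD a c u - YD a c u'‖ ≤ M₂ * δ := norm_YD_sub_YD_le c ha hc hs hg hu hu'
  refine ContinuousLinearMap.opNorm_le_bound _ (by positivity) fun v => ?_
  rw [sub_apply, kD_apply, kD_apply]
  -- the four-term telescoping
  have e : exp (Yf a c u) * v + fderiv ℝ exp (Yf a c u) (YD a c u v) * u -
        (exp (Yf a c u') * v + fderiv ℝ exp (Yf a c u') (YD a c u' v) * u') =
      (exp (Yf a c u) - exp (Yf a c u')) * v + fderiv ℝ exp (Yf a c u) (YD a c u v) * (u - u') +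
        (fderiv ℝ (exp : ℍ → ℍ) (Yf a c u) - fderiv ℝ (exp : ℍ → ℍ) (Yf a c u')) (YD a c u v) * u' +
        fderiv ℝ exp (Yf a c u') ((YD a c u - YD a c u') v) * u' := by
    simp only [sub_apply, map_sub]
    noncomm_ring
  rw [e]
  have t1 : ‖(exp (Yf a c u) - exp (Yf a c u')) * v‖ ≤ E * (8 / 5 * δ) * ‖v‖ :=
    (norm_mul_le _ _).trans (mul_le_mul_of_nonneg_right hee (norm_nonneg _))
  have t2 : ‖fderiv ℝ exp (Yf a c u) (YD a c u v) * (u - u')‖ ≤ E * (M₁ * ‖v‖) * δ := by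
    calc ‖fderiv ℝ exp (Yf a c u) (YD a c u v) * (u - u')‖ ≤ ‖fderiv ℝ exp (Yf a c u) (YD a c u v)‖ * ‖u - u'‖ := norm_mul_le _ _
      _ ≤ (‖fderiv ℝ (exp : ℍ → ℍ) (Yf a c u)‖ * (‖YD a c u‖ * ‖v‖)) * ‖u - u'‖ :=
          mul_le_mul_of_nonneg_right ((ContinuousLinearMap.le_opNorm _ _).trans
            (mul_le_mul_of_nonneg_left (ContinuousLinearMap.le_opNorm _ _) (norm_nonneg _))) (norm_nonneg _)
      _ ≤ (E * (M₁ * ‖v‖)) * δ := by rw [hδ]; gcongr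
  have t3 : ‖(fderiv ℝ (exp : ℍ → ℍ) (Yf a c u) - fderiv ℝ (exp : ℍ → ℍ) (Yf a c u')) (YD a c u v) * u'‖ ≤ (E * (8 / 5 * δ)) * (M₁ * ‖v‖) * (25 / 24) := by
    calc ‖(fderiv ℝ (exp : ℍ → ℍ) (Yf a c u) - fderiv ℝ (exp : ℍ → ℍ) (Yf a c u')) (YD a c u v) * u'‖
        ≤ ‖(fderiv ℝ (exp : ℍ → ℍ) (Yf a c u) - fderiv ℝ (exp : ℍ → ℍ) (Yf a c u')) (YD a c u v)‖ * ‖u'‖ := norm_mul_le _ _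
      _ ≤ (‖fderiv ℝ (exp : ℍ → ℍ) (Yf a c u) - fderiv ℝ (exp : ℍ → ℍ) (Yf a c u')‖ * (‖YD a c u‖ * ‖v‖)) * ‖u'‖ :=
          mul_le_mul_of_nonneg_right ((ContinuousLinearMap.le_opNorm _ _).trans
            (mul_le_mul_of_nonneg_left (ContinuousLinearMap.le_opNorm _ _) (norm_nonneg _))) (norm_nonneg _)
      _ ≤ ((E * (8 / 5 * δ)) * (M₁ * ‖v‖)) * (25 / 24) := by gcongr
  have t4 : ‖fderiv ℝ exp (Yf a c u') ((YD a c u - YD a c u') v) * u'‖ ≤ (E * (M₂ * δ * ‖v‖)) * (25 / 24) := by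
    calc ‖fderiv ℝ exp (Yf a c u') ((YD a c u - YD a c u') v) * u'‖ ≤ ‖fderiv ℝ exp (Yf a c u') ((YD a c u - YD a c u') v)‖ * ‖u'‖ := norm_mul_le _ _
      _ ≤ (‖fderiv ℝ (exp : ℍ → ℍ) (Yf a c u')‖ * (‖YD a c u - YD a c u'‖ * ‖v‖)) * ‖u'‖ :=
          mul_le_mul_of_nonneg_right ((ContinuousLinearMap.le_opNorm _ _).trans
            (mul_le_mul_of_nonneg_left (ContinuousLinearMap.le_opNorm _ _) (norm_nonneg _))) (norm_nonneg _)
      _ ≤ (E * (M₂ * δ * ‖v‖)) * (25 / 24) := by gcongr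
  calc ‖(exp (Yf a c u) - exp (Yf a c u')) * v + fderiv ℝ exp (Yf a c u) (YD a c u v) * (u - u') +
          (fderiv ℝ (exp : ℍ → ℍ) (Yf a c u) - fderiv ℝ (exp : ℍ → ℍ) (Yf a c u')) (YD a c u v) * u' +
          fderiv ℝ exp (Yf a c u') ((YD a c u - YD a c u') v) * u'‖
      ≤ ‖(exp (Yf a c u) - exp (Yf a c u')) * v‖ + ‖fderiv ℝ exp (Yf a c u) (YD a c u v) * (u - u')‖ +
          ‖(fderiv ℝ (exp : ℍ → ℍ) (Yf a c u) - fderiv ℝ (exp : ℍ → ℍ) (Yf a c u')) (YD a c u v) * u'‖ +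
          ‖fderiv ℝ exp (Yf a c u') ((YD a c u - YD a c u') v) * u'‖ := by
        refine (norm_add_le _ _).trans (add_le_add ((norm_add_le _ _).trans (add_le_add (norm_add_le _ _) le_rfl)) le_rfl)
    _ ≤ E * (8 / 5 * δ) * ‖v‖ + E * (M₁ * ‖v‖) * δ + (E * (8 / 5 * δ)) * (M₁ * ‖v‖) * (25 / 24) + (E * (M₂ * δ * ‖v‖)) * (25 / 24) :=
        add_le_add (add_le_add (add_le_add t1 t2) t3) t4
    _ = (E * (8 / 5 + M₁ + 25 / 24 * (8 / 5 * M₁ + M₂))) * δ * ‖v‖ := by ring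
    _ = (E * (8 / 5 + M₁ + 25 / 24 * (8 / 5 * M₁ + M₁ ^ 2 * (8 / 5) * E))) * ‖u - u'‖ * ‖v‖ := by rw [hM₂, hδ]

/-- NUMERAL: `K₁ ≤ 14`. [folklore] -/
theorem K₁_le : 1 + 3 / 5 * Real.exp (3 / 5) + 25 / 24 * Real.exp (3 / 5) * (2 - Real.exp (3 / 5))⁻¹ ≤ (14 : ℝ) := by
  have he := exp_three_fifths_lt
  have h6 := inv_floor_le_six
  have h0 : 0 ≤ (2 - Real.exp (3 / 5))⁻¹ := inv_nonneg.2 floor_pos.le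
  have he0 : 0 ≤ Real.exp (3 / 5) := (Real.exp_pos _).le
  nlinarith [mul_le_mul he.le h6 h0 (by norm_num : (0:ℝ) ≤ 183 / 100)]

/-- NUMERAL: `Λ₂ ≤ 250`. [folklore] -/
theorem Λ₂_le : Real.exp (3 / 5) * (8 / 5 + (2 - Real.exp (3 / 5))⁻¹ +
    25 / 24 * (8 / 5 * (2 - Real.exp (3 / 5))⁻¹ + ((2 - Real.exp (3 / 5))⁻¹) ^ 2 * (8 / 5) * Real.exp (3 / 5))) ≤ (250 : ℝ) := by
  have he := exp_three_fifths_lt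
  have h6 := inv_floor_le_six
  have hL := lipschitz_const_le
  have h0 : 0 ≤ (2 - Real.exp (3 / 5))⁻¹ := inv_nonneg.2 floor_pos.le
  have he0 : 0 ≤ Real.exp (3 / 5) := (Real.exp_pos _).le
  have hin : 8 / 5 + (2 - Real.exp (3 / 5))⁻¹ + 25 / 24 * (8 / 5 * (2 - Real.exp (3 / 5))⁻¹ + ((2 - Real.exp (3 / 5))⁻¹) ^ 2 * (8 / 5) * Real.exp (3 / 5))
      ≤ 8 / 5 + 6 + 25 / 24 * (8 / 5 * 6 + 110) := by nlinarith
  have hin0 : 0 ≤ 8 / 5 + (2 - Real.exp (3 / 5))⁻¹ + 25 / 24 * (8 / 5 * (2 - Real.exp (3 / 5))⁻¹ + ((2 - Real.exp (3 / 5))⁻¹) ^ 2 * (8 / 5) * Real.exp (3 / 5)) := by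
    positivity
  calc Real.exp (3 / 5) * _ ≤ 183 / 100 * (8 / 5 + 6 + 25 / 24 * (8 / 5 * 6 + 110)) := mul_le_mul he.le hin hin0 (by norm_num)
    _ ≤ 250 := by norm_num

end Region

end Summit.QuantumFields.YangMills.Theorems.UV3FibreDerivativeLipschitz

end
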